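import Summits.Ventures.CertifiedManyBodySolver.Observables.GHFClassFloorGram
import Literature.MathematicalPhysics.QuantumLattice.HubbardTTPrimeFreeKineticBound
import Literature.MathematicalPhysics.QuantumLattice.HubbardGroundStateLatticeCovariance
import Literature.MathematicalPhysics.QuantumLattice.HubbardLangerMattisTorus
import HarnessLib

/-!
# Ventures/CertifiedManyBodySolver — Observables/GHFClassFloor.lean
# The energy floor of the COMPLETE generalised-Hartree–Fock (quasi-free) class of the `t–t'` Hubbard
# model: `e ≥ -(1/(U|Λ|)) Σ_{xy} |t_{xy}|² - (U/2) n (1 - n)`, i.e. `e ≥ -4t²/U` at half filling (part 2 of 2;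
# part 1: `GHFClassFloorGram.lean`)

HONEST FRAMING: first certified bounds; not a superconductivity verdict; every number certified or labelled float.
A competing-order EXCLUSION removes a named class of candidate ground states; it never says which order is present;
no phase sentence follows.

Cell `hubbard-tc` (MO-S3, D-0096), seat `hubbard-tc-mod-3` (G3: competing orders — stripe/CDW/AF — as EXCLUSION
inputs from certified energy ORDERINGS), `prover-hubbard-tc-mod-3-g9-0`. Family `hubbard`; namespace
`Summit.Ventures.CertifiedManyBodySolver.Observables.GHFClassFloor`.

## The class (X1-GHF: it contains X1a, X1b and X1-AF of the cell's ASSUMPTIONS §3)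

A Fock vector `φ ≠ 0` on the orbitals `Λ × {↑,↓}` with mean density `n` (`Re⟨N̂⟩ = n|Λ|‖φ‖²`) belongs to the
**generalised-Hartree–Fock (gHF) class** if its double occupancy is at least the Hartree–Fock value OF ITS OWN
local charge-and-spin texture:

  `Re⟨D̂⟩ · ‖φ‖² ≥ (n²/4)|Λ|‖φ‖⁴ - Σ_x |⟨S_x⟩|²`,  `|⟨S_x⟩|² := ¼ (Re⟨n_{x↑} - n_{x↓}⟩)² + |⟨c†_{x↑} c_{x↓}⟩|²`

(`D̂ = Σ_x n_{x↑}n_{x↓}`; for `‖φ‖ = 1` the right side is `(n/2)²|Λ| - Σ_x |⟨S_x⟩|²`, `⟨S_x⟩` the local spin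
vector). By Wick's rule `⟨n_{x↑}n_{x↓}⟩ = ⟨n_{x↑}⟩⟨n_{x↓}⟩ - |⟨c†_{x↑}c_{x↓}⟩|² + |⟨c_{x↓}c_{x↑}⟩|² ≥ n_x²/4 - |⟨S_x⟩|²`
and Jensen `Σ_x n_x² ≥ |Λ| n²`, EVERY quasi-free state — every Slater determinant and every
Hartree–Fock–Bogoliubov / BCS vacuum, with ANY spin texture (collinear or not, of any period: Néel, stripes of
any orientation and period, spirals, canted or ferrimagnetic textures, ferromagnetic domains, spin polarons), ANY
charge texture (charge-density waves, phase-separated Hartree–Fock states) and ANY pairing (s- or d-wave BCS, pair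
density waves, coexisting antiferromagnetic + superconducting mean fields) — is in the class [BachLiebSolovej1994,
§2, eq. (2c.36): the 1-pdm of a quasi-free state determines all its correlation functions by Wick's theorem].
The class also contains the cell's earlier trial classes: the non-magnetic MF/BCS class `docc ≥ (n/2)²` (X1a),
the saturated ferromagnet (X1b: `docc = 0 = (n/2)² - (n/2)²`) and the Néel mean-field class `docc ≥ (n/2)² - m_s²`
(X1-AF: `Σ_x|⟨S_x⟩|² ≥ |Λ| m_s²`).

## The floor (hypothesis-free kernel theorem; real-space proof, no Fourier analysis, no majorant menu)

On the `L × L` torus, `L ≥ 3`, hopping `t` (nearest) and `t'` (next-nearest), EVERY `U > 0`, every filling: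

  `Re⟨φ, H(t,t',U) φ⟩ ≥ L²‖φ‖² · ( -(1/(U L²)) Σ_{x,y} |A_{xy}|² - (U/2) n (1 - n) )`   (`re_expect_hubbardTorusTT'_ge_ghfClass`),

`A = ttHopMatrix` the one-body hopping matrix; at `t' = 0`, `Σ_{xy}|A_{xy}|² = 4t²L²`, so the gHF class obeys
**`e ≥ -4t²/U - (U/2) n(1 - n)`**, i.e. **`e ≥ -4t²/U = -J` at half filling** (`ghfClass_energy_per_site_ge`).
(At half filling and large `U` this is the Néel Hartree–Fock energy `-4t²/U + O(t⁴/U³)`, the gHF optimum by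
[BachLiebSolovej1994, Thm. 4.5]; the true ground state gains the superexchange fluctuation energy `≈ -1.17 J`
beyond it — the G3 words `GHFClassExclusionHalfFilling.lean` certify that gap against the tree's certified caps.)

Proof. Write `g_{ij} = ⟨c_i φ, c_j φ⟩ = ⟨φ, c†_i c_j φ⟩` (`i, j ∈ Λ × {↑,↓}`), `G_{xy} = Σ_σ g_{(xσ)(yσ)}`,
`ns = ‖φ‖²`. (1) PAULI: `Σ_j |g_{ij}|² ≤ ns · g_{ii}` (CAR: `‖c(f)ψ‖² ≤ ‖f‖²‖ψ‖²` for the smeared mode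
`f_j = g_{ij}`, and Cauchy–Schwarz) — summed, `Σ_{ij}|g_{ij}|² ≤ ns Re⟨N̂⟩`. (2) LOCAL MOMENTS: per pair `(x,y)` the
parallelogram identity `|a+d|² + |a-d|² + 2|b|² + 2|c|² = 2(|a|²+|b|²+|c|²+|d|²)` for the four spin entries; on the
diagonal `|a-d|² = (Re⟨n_{x↑}-n_{x↓}⟩)²` and `|b| = |c| = |⟨c†_{x↑}c_{x↓}⟩|`; dropping the off-diagonal `|a-d|², |b|²,
|c|²` gives `4 Σ_x|⟨S_x⟩|² + Σ_{xy}|G_{xy}|² ≤ 2 ns Re⟨N̂⟩`. (3) ONE COMPLETED SQUARE: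
`0 ≤ Σ_{xy} |(U/2) G_{xy} + ns (A_{xy} - c δ_{xy})|²` reads `ns Re⟨H(t,t',0)⟩ + (U/4)Σ|G|² ≥ c ns Re⟨N̂⟩ -
(ns²/U)(Σ|A|² + c²L²)` (`A` real symmetric with zero diagonal, `Re⟨H(t,t',0)⟩ = Σ_{xy} A_{xy} Re G_{xy}`).
(4) Add `U ×` the class inequality, (2) and (3) with `c = U n/2`.

Everything here is PROVED (0 sorry, no new definition, standard axioms); the class enters only as the hypothesis
`hD` of the final theorems, in the cell's established style (`NeelClassKineticFloor.lean`).

WHAT THIS IS NOT: a statement that antiferromagnetic, stripe or any other ORDER is absent (the excluded objects are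
mean-field TRIAL STATES, not order parameters); a phase word; a statement about `T_c`.

## Tree / Mathlib search

REUSED: `hubbardTorusTT'`, `ttHopMatrix`, `hubbardTorusTT'_zero_eq_dGammaSpin`, `hubbardTorusTT'_eq_add_smul`
(`HubbardTTPrimeFreeKineticBound`); `LangerMattis.dGammaSpin`, `hopMatrix` (`HubbardLangerMattisBound`);
`RayleighBound.annihilate`, `create`, `normSq`, `annihilate_mul_create_add`, `star_dotProduct_self_eq_normSq`
(`HubbardWave0RayleighProofs`); `HubbardBandBottom.star_dotProduct_numberMode_mulVec`,
`star_dotProduct_annihilate_create_mulVec` (`HubbardBandBottomModes`); `card_filter_fermionTorusGraph_adj`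
(`HubbardGroundStateLatticeCovariance`); `card_fermionTorus_eq` (`HubbardLangerMattisTorus`). Mathlib:
`norm_inner_le_norm`, `EuclideanSpace.inner_toLp_toLp`, `EuclideanSpace.norm_sq_eq`, `parallelogram_law_with_norm`,
`norm_star`, `Matrix.star_dotProduct`. `lean search 'Hartree.*floor|quasi.?free.*lower|ghf'`: the tree has the
non-magnetic gHF floor `HubbardGHFNonmagneticFloor` (X1a device) and the Néel-class floor, no bound for general spin
textures.

## References

* V. Bach, E. H. Lieb, J. P. Solovej, *Generalized Hartree–Fock theory and the Hubbard model*, J. Stat. Phys. 76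
  (1994) 3–89, §2 (quasi-free states, eq. (2c.36)) and Thm. 4.5 (the gHF ground state at half filling).
  [BachLiebSolovej1994]
* E. H. Lieb, *Variational principle for many-fermion systems*, Phys. Rev. Lett. 46 (1981) 457 (the HF class).
  [Lieb1981]
* O. Bratteli, D. W. Robinson, *Operator Algebras and Quantum Statistical Mechanics II* (1997) §5.2.2, Prop. 5.2.2
  (`‖a(f)‖ = ‖f‖`). [BratteliRobinsonII1997]
-/

noncomputable section

namespace Summit.Ventures.CertifiedManyBodySolver.Observables

namespace GHFClassFloor

open Literature.MathematicalPhysics.QuantumLattice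
open Matrix Finset Literature.Probability.LatticeModels
  Literature.MathematicalPhysics.QuantumLattice.RayleighBound
  Literature.MathematicalPhysics.QuantumLattice.HubbardBandBottom
  Literature.MathematicalPhysics.QuantumLattice.LangerMattis
  Literature.MathematicalPhysics.QuantumLattice.TTPrimeFree
open scoped ComplexOrder ComplexConjugate

/-! ### §3 The completed square on the `t–t'` torus and the class floor -/

section Torus

variable {L : ℕ} [NeZero L]

omit [NeZero L] in
/-- The `t–t'` hopping matrix has real entries. [cite: XuEtAl2024, eq. (1)] -/
theorem ttHopMatrix_im (t t' : ℝ) (x y : FermionTorus 2 L) : (ttHopMatrix L t t' x y).im = 0 := by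
  simp only [ttHopMatrix, hopMatrix, Matrix.add_apply, Matrix.of_apply]
  split_ifs <;> simp

omit [NeZero L] in
/-- The `t–t'` hopping matrix has zero diagonal (no on-site term). [cite: XuEtAl2024, eq. (1)] -/
theorem ttHopMatrix_apply_self (t t' : ℝ) (x : FermionTorus 2 L) : ttHopMatrix L t t' x x = 0 := by
  simp only [ttHopMatrix, hopMatrix, Matrix.add_apply, Matrix.of_apply, SimpleGraph.irrefl, if_false,
    add_zero]

/-- **`Σ_{x,y} |A_{xy}|² = 4t²L²` at `t' = 0`** (`L ≥ 3`: four distinct nearest neighbours per site).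
[cite: FriedliVelenik2017, §3.1] -/
theorem sum_norm_sq_ttHopMatrix_zero (hL : 3 ≤ L) (t : ℝ) :
    ∑ x : FermionTorus 2 L, ∑ y : FermionTorus 2 L, ‖ttHopMatrix L t 0 x y‖ ^ 2 =
      4 * t ^ 2 * (L : ℝ) ^ 2 := by
  classical
  have hxy : ∀ x y : FermionTorus 2 L, ‖ttHopMatrix L t 0 x y‖ ^ 2 =
      if (fermionTorusGraph 2 L).Adj x y then t ^ 2 else 0 := by
    intro x y
    simp only [ttHopMatrix, hopMatrix, Matrix.add_apply, Matrix.of_apply, neg_zero, Complex.ofReal_zero,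
      ite_self, add_zero]
    split_ifs
    · rw [Complex.norm_real, Real.norm_eq_abs, sq_abs, neg_sq]
    · simp
  have hx : ∀ x : FermionTorus 2 L, ∑ y, ‖ttHopMatrix L t 0 x y‖ ^ 2 = 4 * t ^ 2 := by
    intro x
    simp_rw [hxy x]
    rw [Finset.sum_ite, Finset.sum_const_zero, add_zero, Finset.sum_const,
      card_filter_fermionTorusGraph_adj hL x, nsmul_eq_mul]
    push_cast; ring
  simp_rw [hx]
  rw [Finset.sum_const, Finset.card_univ, card_fermionTorus_eq, nsmul_eq_mul]
  push_cast; ring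

omit [NeZero L] in
/-- `Re⟨φ, dΓ_σ(A) φ⟩ = Σ_{x,y} Re A_{xy} · Re⟨φ, c†_{xσ}c_{yσ} φ⟩` for the (real) `t–t'` hopping matrix.
[cite: LiebLoss1993, §8 eq. (8.1)] -/
theorem re_expect_dGammaSpin_ttHopMatrix (t t' : ℝ) (σ : Fin 2) (φ : Fock (Orb (FermionTorus 2 L))) :
    (star φ ⬝ᵥ (dGammaSpin σ (ttHopMatrix L t t') *ᵥ φ)).re =
      ∑ x, ∑ y, (ttHopMatrix L t t' x y).re *
        (star φ ⬝ᵥ ((creation (orb x σ) * annihilation (orb y σ)) *ᵥ φ)).re := by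
  rw [dGammaSpin, Matrix.sum_mulVec, dotProduct_sum, Complex.re_sum]
  refine Finset.sum_congr rfl fun x _ => ?_
  rw [Matrix.sum_mulVec, dotProduct_sum, Complex.re_sum]
  refine Finset.sum_congr rfl fun y _ => ?_
  rw [Matrix.smul_mulVec, dotProduct_smul, smul_eq_mul, Complex.mul_re, ttHopMatrix_im, zero_mul,
    sub_zero]

/-- **The energy floor of the generalised-Hartree–Fock class** (every `U > 0`, every filling, every `t'`).
On `(ℤ/Lℤ)²` with hopping matrix `A = A_{tt'}`: a Fock vector with `Re⟨N̂⟩ = nL²‖φ‖²` whose double occupancy is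
at least the Hartree–Fock value of its own local charge/spin texture,
`(n²/4)L²‖φ‖⁴ - Σ_x(¼Re⟨n_{x↑}-n_{x↓}⟩² + |⟨c†_{x↑}c_{x↓}⟩|²) ≤ Re⟨D̂⟩‖φ‖²`
— every quasi-free (Slater / HFB / BCS) state with ANY spin, charge and pairing texture is such a vector — obeys
`L²‖φ‖² · ( -(Σ_{xy}|A_{xy}|²)/(U L²) - (U/2) n (1-n) ) ≤ Re⟨φ, H(t,t',U) φ⟩`.
[cite: BachLiebSolovej1994, §2 eq. (2c.36)] -/
theorem re_expect_hubbardTorusTT'_ge_ghfClass (t t' : ℝ) {U n : ℝ} (hU : 0 < U)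
    (φ : Fock (Orb (FermionTorus 2 L)))
    (hN : (star φ ⬝ᵥ (totalNumber *ᵥ φ)).re = n * (L : ℝ) ^ 2 * normSq φ)
    (hD : (n ^ 2 / 4) * (L : ℝ) ^ 2 * normSq φ * normSq φ -
        ∑ x : FermionTorus 2 L, (((star φ ⬝ᵥ ((numberOp x 0 - numberOp x 1) *ᵥ φ)).re) ^ 2 / 4 +
          ‖star φ ⬝ᵥ ((creation (orb x 0) * annihilation (orb x 1)) *ᵥ φ)‖ ^ 2) ≤
      (star φ ⬝ᵥ ((∑ x : FermionTorus 2 L, numberOp x 0 * numberOp x 1) *ᵥ φ)).re * normSq φ) :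
    (L : ℝ) ^ 2 * normSq φ *
        (-(∑ x : FermionTorus 2 L, ∑ y : FermionTorus 2 L, ‖ttHopMatrix L t t' x y‖ ^ 2) /
            (U * (L : ℝ) ^ 2) - U / 2 * n * (1 - n)) ≤
      (star φ ⬝ᵥ (hubbardTorusTT' L t t' U *ᵥ φ)).re := by
  classical
  -- names
  obtain ⟨ns, hns⟩ : ∃ ns : ℝ, ns = normSq φ := ⟨_, rfl⟩
  obtain ⟨A, hA⟩ : ∃ A : Matrix (FermionTorus 2 L) (FermionTorus 2 L) ℂ, A = ttHopMatrix L t t' := ⟨_, rfl⟩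
  obtain ⟨G, hG⟩ : ∃ G : FermionTorus 2 L → FermionTorus 2 L → ℂ,
      G = fun x y => ∑ σ : Fin 2, star φ ⬝ᵥ ((creation (orb x σ) * annihilation (orb y σ)) *ᵥ φ) :=
    ⟨_, rfl⟩
  have hGxy : ∀ x y, G x y = ∑ σ : Fin 2, star φ ⬝ᵥ ((creation (orb x σ) * annihilation (orb y σ)) *ᵥ φ) :=
    fun x y => by rw [hG]
  obtain ⟨N₁, hN₁⟩ : ∃ N₁ : ℝ, N₁ = (star φ ⬝ᵥ (totalNumber *ᵥ φ)).re := ⟨_, rfl⟩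
  obtain ⟨E₀, hE₀⟩ : ∃ E₀ : ℝ, E₀ = (star φ ⬝ᵥ (hubbardTorusTT' L t t' 0 *ᵥ φ)).re := ⟨_, rfl⟩
  obtain ⟨D₁, hD₁⟩ : ∃ D₁ : ℝ,
      D₁ = (star φ ⬝ᵥ ((∑ x : FermionTorus 2 L, numberOp x 0 * numberOp x 1) *ᵥ φ)).re := ⟨_, rfl⟩
  obtain ⟨SS, hSS⟩ : ∃ SS : ℝ, SS = ∑ x : FermionTorus 2 L,
      (((star φ ⬝ᵥ ((numberOp x 0 - numberOp x 1) *ᵥ φ)).re) ^ 2 +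
        4 * ‖star φ ⬝ᵥ ((creation (orb x 0) * annihilation (orb x 1)) *ᵥ φ)‖ ^ 2) := ⟨_, rfl⟩
  obtain ⟨GF, hGF⟩ : ∃ GF : ℝ, GF = ∑ x, ∑ y, ‖G x y‖ ^ 2 := ⟨_, rfl⟩
  obtain ⟨F, hF⟩ : ∃ F : ℝ, F = ∑ x, ∑ y, ‖A x y‖ ^ 2 := ⟨_, rfl⟩
  have hL0 : (Fintype.card (FermionTorus 2 L) : ℝ) = (L : ℝ) ^ 2 := by
    rw [card_fermionTorus_eq]; push_cast; ring
  -- the energy splits as `E₀ + U D₁`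
  have hE : (star φ ⬝ᵥ (hubbardTorusTT' L t t' U *ᵥ φ)).re = E₀ + U * D₁ := by
    rw [hubbardTorusTT'_eq_add_smul t t' 0 U, Matrix.add_mulVec, dotProduct_add, Complex.add_re,
      Matrix.smul_mulVec, dotProduct_smul, smul_eq_mul, Complex.re_ofReal_mul, sub_zero, hE₀, hD₁]
  -- (2) local moments: `SS + GF ≤ 2 ns N₁`
  have h2 : SS + GF ≤ 2 * ns * N₁ := by
    have h := four_localMoment_add_frob_le φ
    rw [hSS, hGF, hns, hN₁]
    simp_rw [hGxy]
    exact h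
  -- the class hypothesis: `(n²/4) L² ns² - SS/4 ≤ D₁ ns`
  have hcls : (n ^ 2 / 4) * (L : ℝ) ^ 2 * ns * ns - SS / 4 ≤ D₁ * ns := by
    have e : SS / 4 = ∑ x : FermionTorus 2 L,
        (((star φ ⬝ᵥ ((numberOp x 0 - numberOp x 1) *ᵥ φ)).re) ^ 2 / 4 +
          ‖star φ ⬝ᵥ ((creation (orb x 0) * annihilation (orb x 1)) *ᵥ φ)‖ ^ 2) := by
      rw [hSS, Finset.sum_div]
      refine Finset.sum_congr rfl fun x _ => ?_
      ring
    rw [e, hns, hD₁]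
    exact hD
  -- (3) kinetic energy and the diagonal of `G` in real space
  have hkin : E₀ = ∑ x, ∑ y, (A x y).re * (G x y).re := by
    rw [hE₀, hubbardTorusTT'_zero_eq_dGammaSpin, Matrix.add_mulVec, dotProduct_add, Complex.add_re,
      re_expect_dGammaSpin_ttHopMatrix, re_expect_dGammaSpin_ttHopMatrix, ← Finset.sum_add_distrib, hA]
    refine Finset.sum_congr rfl fun x _ => ?_
    rw [← Finset.sum_add_distrib]
    refine Finset.sum_congr rfl fun y _ => ?_
    rw [hGxy, Fin.sum_univ_two, Complex.add_re]
    ring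
  have hGdiag : ∑ x, (G x x).re = N₁ := by
    rw [hN₁, totalNumber, Matrix.sum_mulVec, dotProduct_sum, Complex.re_sum]
    refine Finset.sum_congr rfl fun x _ => ?_
    rw [hGxy, Matrix.sum_mulVec, dotProduct_sum]
    rfl
  have hAim : ∀ x y, (A x y).im = 0 := by intro x y; rw [hA]; exact ttHopMatrix_im t t' x y
  have hAxx : ∀ x, A x x = 0 := by intro x; rw [hA]; exact ttHopMatrix_apply_self t t' x
  have hAnorm : ∀ x y, ‖A x y‖ ^ 2 = (A x y).re ^ 2 := by
    intro x y
    rw [Complex.sq_norm, Complex.normSq_apply, hAim]; ring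
  have hGnorm : ∀ x y, ‖G x y‖ ^ 2 = (G x y).re ^ 2 + (G x y).im ^ 2 := by
    intro x y
    rw [Complex.sq_norm, Complex.normSq_apply]; ring
  -- the completed square
  obtain ⟨c, hc⟩ : ∃ c : ℝ, c = U * n / 2 := ⟨_, rfl⟩
  have hsq : 0 ≤ ∑ x, ∑ y, ((U / 2 * (G x y).re + ns * ((A x y).re - if x = y then c else 0)) ^ 2 +
      (U / 2 * (G x y).im) ^ 2) :=
    Finset.sum_nonneg fun x _ => Finset.sum_nonneg fun y _ => by positivity
  have hexpand : ∑ x, ∑ y, ((U / 2 * (G x y).re + ns * ((A x y).re - if x = y then c else 0)) ^ 2 +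
      (U / 2 * (G x y).im) ^ 2) =
      U ^ 2 / 4 * GF + U * ns * E₀ - U * ns * c * N₁ + ns ^ 2 * F + ns ^ 2 * c ^ 2 * (L : ℝ) ^ 2 := by
    have e1 : ∀ x y, ((U / 2 * (G x y).re + ns * ((A x y).re - if x = y then c else 0)) ^ 2 +
        (U / 2 * (G x y).im) ^ 2) =
        U ^ 2 / 4 * ‖G x y‖ ^ 2 + U * ns * ((A x y).re * (G x y).re) -
          U * ns * c * (if x = y then (G x y).re else 0) + ns ^ 2 * ‖A x y‖ ^ 2 -
          2 * ns ^ 2 * c * (if x = y then (A x y).re else 0) + ns ^ 2 * c ^ 2 * (if x = y then 1 else 0) := by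
      intro x y
      rw [hGnorm, hAnorm]
      split_ifs <;> ring
    simp_rw [e1]
    simp only [Finset.sum_add_distrib, Finset.sum_sub_distrib, ← Finset.mul_sum, Finset.sum_ite_eq,
      Finset.mem_univ, if_true]
    rw [← hGF, ← hkin, hGdiag, ← hF, Finset.sum_const, Finset.card_univ, nsmul_eq_mul, mul_one, hL0]
    simp_rw [hAxx, Complex.zero_re, Finset.sum_const_zero]
    ring
  rw [hexpand] at hsq
  -- assemble
  have hns0 : 0 ≤ ns := by rw [hns]; exact normSq_nonneg φ
  have hN₁' : N₁ = n * (L : ℝ) ^ 2 * ns := by rw [hN₁, hN, hns]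
  have hF' : (∑ x : FermionTorus 2 L, ∑ y : FermionTorus 2 L, ‖ttHopMatrix L t t' x y‖ ^ 2) = F := by
    rw [hF, hA]
  rw [hE, hF', ← hns]
  rw [hN₁'] at h2 hsq
  rw [hc] at hsq
  have hL' : (L : ℝ) ≠ 0 := by exact_mod_cast (NeZero.ne L)
  have hU0 : U ≠ 0 := hU.ne'
  have hX : (L : ℝ) ^ 2 * ns * (-F / (U * (L : ℝ) ^ 2) - U / 2 * n * (1 - n)) =
      (-(ns * F) - U ^ 2 / 2 * (L : ℝ) ^ 2 * ns * n * (1 - n)) / U := by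
    field_simp
  rw [hX, div_le_iff₀ hU]
  rcases hns0.lt_or_eq with hpos | hzero
  · -- `‖φ‖ > 0`: the three inequalities, scaled by powers of `U`, add up
    have hA1 : U ^ 2 * ((n ^ 2 / 4) * (L : ℝ) ^ 2 * ns * ns - SS / 4) ≤ U ^ 2 * (D₁ * ns) :=
      mul_le_mul_of_nonneg_left hcls (pow_nonneg hU.le 2)
    have hA2 : U ^ 2 / 4 * (SS + GF) ≤ U ^ 2 / 4 * (2 * ns * (n * (L : ℝ) ^ 2 * ns)) :=
      mul_le_mul_of_nonneg_left h2 (by positivity)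
    have key : ns * (-(ns * F) - U ^ 2 / 2 * (L : ℝ) ^ 2 * ns * n * (1 - n)) ≤
        ns * ((E₀ + U * D₁) * U) := by
      linarith [hA1, hA2, hsq]
    exact le_of_mul_le_mul_left key hpos
  · -- `φ = 0`: both sides vanish
    have hφ : φ = 0 := HubbardBandBottom.eq_zero_of_normSq_eq_zero (by rw [← hns, ← hzero])
    rw [← hzero, hE₀, hD₁, hφ]
    simp

/-- **Per-site form at `t' = 0`: the gHF class obeys `e ≥ -4t²/U - (U/2) n (1 - n)`** on every torus `L ≥ 3`,
every `U > 0`; at half filling `e ≥ -4t²/U`. [cite: BachLiebSolovej1994, §2 eq. (2c.36)] -/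
theorem ghfClass_energy_per_site_ge (hL : 3 ≤ L) (t : ℝ) {U n : ℝ} (hU : 0 < U)
    {φ : Fock (Orb (FermionTorus 2 L))} (hφ : φ ≠ 0)
    (hN : (star φ ⬝ᵥ (totalNumber *ᵥ φ)).re = n * (L : ℝ) ^ 2 * normSq φ)
    (hD : (n ^ 2 / 4) * (L : ℝ) ^ 2 * normSq φ * normSq φ -
        ∑ x : FermionTorus 2 L, (((star φ ⬝ᵥ ((numberOp x 0 - numberOp x 1) *ᵥ φ)).re) ^ 2 / 4 +
          ‖star φ ⬝ᵥ ((creation (orb x 0) * annihilation (orb x 1)) *ᵥ φ)‖ ^ 2) ≤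
      (star φ ⬝ᵥ ((∑ x : FermionTorus 2 L, numberOp x 0 * numberOp x 1) *ᵥ φ)).re * normSq φ) :
    -4 * t ^ 2 / U - U / 2 * n * (1 - n) ≤
      (star φ ⬝ᵥ (hubbardTorusTT' L t 0 U *ᵥ φ)).re / ((L : ℝ) ^ 2 * normSq φ) := by
  have h := re_expect_hubbardTorusTT'_ge_ghfClass t 0 hU φ hN hD
  rw [sum_norm_sq_ttHopMatrix_zero hL t] at h
  have hpos : 0 < normSq φ := by
    rcases (normSq_nonneg φ).lt_or_eq with hlt | heq
    · exact hlt
    · exact absurd (HubbardBandBottom.eq_zero_of_normSq_eq_zero heq.symm) hφ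
  have hL0 : (0 : ℝ) < (L : ℝ) ^ 2 := by
    have : (0 : ℝ) < L := by exact_mod_cast (lt_of_lt_of_le (by norm_num : 0 < 3) hL)
    positivity
  rw [le_div_iff₀ (mul_pos hL0 hpos)]
  have e : -(4 * t ^ 2 * (L : ℝ) ^ 2) / (U * (L : ℝ) ^ 2) = -4 * t ^ 2 / U := by
    field_simp
  rw [e] at h
  linarith

/-- **Half filling, `t' = 0`: every state of the gHF class has energy per site `≥ -4t²/U`** (`L ≥ 3`, `U > 0`).
[cite: BachLiebSolovej1994, Thm. 4.5] -/
theorem ghfClass_energy_per_site_ge_halfFilling (hL : 3 ≤ L) (t : ℝ) {U : ℝ} (hU : 0 < U)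
    {φ : Fock (Orb (FermionTorus 2 L))} (hφ : φ ≠ 0)
    (hN : (star φ ⬝ᵥ (totalNumber *ᵥ φ)).re = 1 * (L : ℝ) ^ 2 * normSq φ)
    (hD : ((1 : ℝ) ^ 2 / 4) * (L : ℝ) ^ 2 * normSq φ * normSq φ -
        ∑ x : FermionTorus 2 L, (((star φ ⬝ᵥ ((numberOp x 0 - numberOp x 1) *ᵥ φ)).re) ^ 2 / 4 +
          ‖star φ ⬝ᵥ ((creation (orb x 0) * annihilation (orb x 1)) *ᵥ φ)‖ ^ 2) ≤
      (star φ ⬝ᵥ ((∑ x : FermionTorus 2 L, numberOp x 0 * numberOp x 1) *ᵥ φ)).re * normSq φ) :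
    -4 * t ^ 2 / U ≤ (star φ ⬝ᵥ (hubbardTorusTT' L t 0 U *ᵥ φ)).re / ((L : ℝ) ^ 2 * normSq φ) := by
  have h := ghfClass_energy_per_site_ge hL t hU hφ hN hD
  linarith

end Torus

end GHFClassFloor

end Summit.Ventures.CertifiedManyBodySolver.Observables

end
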